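import Mathlib
import HarnessLib
import HarnessLib.Audit
import Summits.CriticalPhenomena.Ising3DConformalLimit.Theses.MarkovRigidity

/-!
# Line `birth` — elaborating skeleton for crux `NelsonPolyakovRigidity`
(stmt-CriticalPhenomena-11243; route decl
`Summit.CriticalPhenomena.Ising3DConformalLimit.Theses.MarkovRigidity.NelsonPolyakovRigidity`,
route-CriticalPhenomena-MarkovRigidity, rank 3; skeleton-register, re-audit bin REPAIRABLE).

Crux (NPR, lattice-free, one real scalar field on `𝒮'(ℝ³)`): a probability law `μ` with all and
exponential moments, translation-invariant, scale-covariant law of dimension `Δ ∈ [1/2, 1]`,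
time-reflection invariant, OS-reflection positive, time-clustering, germ-Markov for open balls
and open half-spaces, whose moment densities `S` are normalised / continuous on `NonCoincident`
with `S₂ > 0`, has `S ∘ A` Möbius covariant of weight `Δ` for some `A ∈ GL(3, ℝ)`.

Since `IsMoebiusCovariant Δ T = IsEuclideanInvariant T ∧ IsScaleCovariant Δ T ∧
IsInversionCovariant Δ T`, the crux is cut along its CONTENT seam — exactly the two
"sub-targets" named in the crux docstring and in the route's TWO-LAYER PLAN
(`NelsonPolyakovRigidity ⇐ NPRIsotropy → NPRInversion → NelsonPolyakovRigidity`) — plus the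
provable-now transport lemma that carries the LAW-level covariances of `μ` to the density `S`:

* `stub_transport`  (support-sized, provable now, M–L): law-level translation invariance and
  scale covariance of `μ` + the moment-density identity + normalisation/continuity of `S` on
  `NonCoincident` ⇒ `IsTranslationInvariant S ∧ IsScaleCovariant Δ S`. Proof sketch: test the
  density identity against compactly supported bumps with pairwise disjoint supports (then the
  integrand is continuous with compact support inside `NonCoincident`, so the Bochner integral is
  honest — this is the junk-value check of the crux typing), use `Measure.map` invariance
  (`integral_map`) and linearity of `ω`, change variables, conclude pointwise on `NonCoincident`
  by continuity and off it by normalisation. It also certifies the exponent bookkeeping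
  `s^(Δ-3)·f(s⁻¹·) ⇒ S n (c • x) = c^(-nΔ) S n x` (refuter note, rev 4).
* `stub_isotropy`   (THE METRIC HALF, open, XL — hardest together with `stub_inversion`): under
  all NPR hypotheses there is `A ∈ GL(3, ℝ)` with `S ∘ A` rotation invariant ("the anisotropy of
  a scalar germ-Markov RP scale-covariant field is a metric"). Gaussian case: Kotani 1973 Thm 2
  (germ-Markov ⟺ σ⁻¹ entire of minimal exponential type) + route support
  `HomogeneousEntireRigidity` (PROVED, item 6231) ⇒ σ⁻¹ is a positive-definite quadratic form
  `Q`, `A = Q^{-1/2}`.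
* `stub_inversion`  (THE REVERSIBILITY HALF, open, XL): under all NPR hypotheses, for every
  `A` with `S ∘ A` Euclidean invariant and scale covariant, `S ∘ A` is unit-inversion covariant
  (reversibility of the radial Nelson semigroup generated by dilations on the sphere germ, from
  planar RP + sphere-Markov; Nelson 1973, Osterwalder–Schrader 1973). Given the crux, this ∀-form
  follows from it by the elementary similarity lemma (two Euclidean-invariant, scale-covariant
  linear images of one `S` with `S₂ > 0` differ by a similarity, and Möbius covariance is
  similarity-stable), so the split loses nothing: crux ⟺ isotropy ∧ inversion (mod transport).

Composition `NelsonPolyakovRigidity_of : <sig stub_transport> → <sig stub_isotropy> →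
<sig stub_inversion> → NelsonPolyakovRigidity` (signatures verbatim; the conclusion is the local
reducible alias of the route decl) is a real proof (translation / scale covariance are pushed
through the linear map `A` by `map_add` / `map_smul`, then the three conjuncts of
`IsMoebiusCovariant` are assembled); `NelsonPolyakovRigidity_skeleton :
…Theses.MarkovRigidity.NelsonPolyakovRigidity := NelsonPolyakovRigidity_of stub_transport
stub_isotropy stub_inversion` concludes the crux BY NAME. Sorries: exactly 3, one per `stub_*`,
none elsewhere.

Barriers / negatives honoured. `Literature.Barriers.CriticalPhenomena.ScaleCovarianceNotMoebius`
(`not_inversionUpgrade_of_euclidean_data`, `witnessFamily_not_isInversionCovariant`) and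
`Theorems/IsingEuclidUpgradeRefutations.not_inversionUpgrade_of_euclideanLimit` kill
"Euclidean + scale data of a bare `CorrFamily` ⇒ inversion": `stub_inversion` is NOT that
statement — its inputs are the LAW-level germ-Markov property, OS reflection positivity and
clustering of a measure whose moment densities are `S` (the barrier's scope caveat (a), as in the
route's Barriers section); `stub_isotropy` asks for rotation invariance only up to `GL(3)` (the
free field of a non-round metric meets every hypothesis, so plain rotation invariance would be
FALSE — the `∃ A` is load-bearing). `ledger negatives --problem CriticalPhenomena` (11 entries,
2026-08-17): none concerns this conjunct's covariance statements. No `Disproof.lean` exists for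
this crux yet (no `_false_without_` obligations to honour).
-/

namespace Summit.CriticalPhenomena.Ising3DConformalLimit.Cruxes.NelsonPolyakovRigidity.Birth

set_option linter.dupNamespace false in
/-- Local reducible alias of the crux decl (the `abbrev Crux` pattern of
`Cruxes/InversionUpgradeNormalised/Lines/circumsphere-one-spin-law.lean`): the explicit-hypothesis
composition `NelsonPolyakovRigidity_of` concludes this alias, so that in `#h21_check_skeleton` the
unique theorem concluding the route decl BY NAME is `NelsonPolyakovRigidity_skeleton` (no
hypotheses; sorries only inside the three `stub_*`). -/
abbrev NelsonPolyakovRigidity : Prop :=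
  Summit.CriticalPhenomena.Ising3DConformalLimit.Theses.MarkovRigidity.NelsonPolyakovRigidity

/-! ## The three registered stubs -/

/-- **stub 1 — transport of law-level covariance to the density** (provable now, M–L): law-level
translation invariance / scale covariance of `μ` descend to the moment density `S` (normalised
and continuous on `NonCoincident`). -/
theorem stub_transport : ∀ (μ : MeasureTheory.Measure (Literature.MathematicalPhysics.QuantumLattice.FieldConfig (EuclideanSpace ℝ (Fin 3)))) (Δ : ℝ) (S : Literature.Probability.LatticeModels.CorrFamily 3), MeasureTheory.IsProbabilityMeasure μ → Literature.MathematicalPhysics.QuantumLattice.HasAllMoments μ → Literature.MathematicalPhysics.QuantumLattice.IsTranslationInvariantLaw μ → (∀ (s : ℝ) (hs : 0 < s), MeasureTheory.Measure.map (Literature.MathematicalPhysics.QuantumLattice.FieldConfig.act ((s ^ (Δ - 3 : ℝ)) • Literature.MathematicalPhysics.QuantumLattice.dilateTest s hs.ne')) μ = μ) → (∀ (n : ℕ) (f : Fin n → SchwartzMap (EuclideanSpace ℝ (Fin 3)) ℝ), Literature.MathematicalPhysics.QuantumLattice.moment μ n f = ∫ x : Fin n → EuclideanSpace ℝ (Fin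 3), S n x * ∏ i, f i (x i)) → (∀ n z, z ∉ Literature.Probability.LatticeModels.NonCoincident 3 n → S n z = 0) → (∀ n, ContinuousOn (S n) (Literature.Probability.LatticeModels.NonCoincident 3 n)) → Literature.Probability.LatticeModels.IsTranslationInvariant S ∧ Literature.Probability.LatticeModels.IsScaleCovariant Δ S := by
  sorry

/-- **stub 2 — isotropy up to `GL(3)`** (metric half of NPR; open, XL; Gaussian case = Kotani
1973 Thm 2 + `HomogeneousEntireRigidity`): under every hypothesis of the crux there is a
continuous linear automorphism `A` of `ℝ³` with `S ∘ A` invariant under `O(3)`. -/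
theorem stub_isotropy : ∀ (μ : MeasureTheory.Measure (Literature.MathematicalPhysics.QuantumLattice.FieldConfig (EuclideanSpace ℝ (Fin 3)))) (Δ : ℝ) (S : Literature.Probability.LatticeModels.CorrFamily 3), MeasureTheory.IsProbabilityMeasure μ → Literature.MathematicalPhysics.QuantumLattice.HasAllMoments μ → (∀ f : SchwartzMap (EuclideanSpace ℝ (Fin 3)) ℝ, MeasureTheory.Integrable (fun ω : Literature.MathematicalPhysics.QuantumLattice.FieldConfig (EuclideanSpace ℝ (Fin 3)) => Real.exp (ω f)) μ) → Literature.MathematicalPhysics.QuantumLattice.IsTranslationInvariantLaw μ → (∀ (s : ℝ) (hs : 0 < s), MeasureTheory.Measure.map (Literature.MathematicalPhysics.QuantumLattice.FieldConfig.act ((s ^ (Δ - 3 : ℝ)) • Literature.MathematicalPhysics.QuantumLattice.dilateTest s hs.ne')) μ = μ) → Literature.MathematicalPhysics.QuantumLattice.IsTimeReflectionInvariantLaw 3 μ → (∀ (n : ℕ) (c : Fin n → ℂ) (f : Fin n → SchwartzMap (EuclideanSpace ℝ (Fin 3)) ℝ), (∀ i, tsupport ⇑(f i) ⊆ {x : EuclideanSpace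 ℝ (Fin 3) | 0 < x 0}) → 0 ≤ (∑ i, ∑ j, (starRingEnd ℂ) (c i) * c j * Literature.MathematicalPhysics.QuantumLattice.genFunctional μ (f j - Literature.MathematicalPhysics.QuantumLattice.thetaTest 3 (f i))).re ∧ (∑ i, ∑ j, (starRingEnd ℂ) (c i) * c j * Literature.MathematicalPhysics.QuantumLattice.genFunctional μ (f j - Literature.MathematicalPhysics.QuantumLattice.thetaTest 3 (f i))).im = 0) → (∀ f g : SchwartzMap (EuclideanSpace ℝ (Fin 3)) ℝ, Filter.Tendsto (fun t : ℝ => Literature.MathematicalPhysics.QuantumLattice.genFunctional μ (f + Literature.MathematicalPhysics.QuantumLattice.timeShiftTest 3 t g)) Filter.atTop (nhds (Literature.MathematicalPhysics.QuantumLattice.genFunctional μ f * Literature.MathematicalPhysics.QuantumLattice.genFunctional μ g))) → (∀ (sig : Set (EuclideanSpace ℝ (Fin 3)) → MeasurableSpace (Literature.MathematicalPhysics.QuantumLattice.FieldConfig (EuclideanSpace ℝ (Fin 3)))), (sig = fun A => ⨆ (f : SchwartzMap (EuclideanSpace ℝ (Fin 3)) ℝ) (_ : tsupport ⇑f ⊆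 A), MeasurableSpace.comap (fun ω : Literature.MathematicalPhysics.QuantumLattice.FieldConfig (EuclideanSpace ℝ (Fin 3)) => ω f) (borel ℝ)) → ∀ (U : Set (EuclideanSpace ℝ (Fin 3))), ((∃ (c : EuclideanSpace ℝ (Fin 3)) (r : ℝ), U = Metric.ball c r) ∨ (∃ (v : EuclideanSpace ℝ (Fin 3)) (a : ℝ), v ≠ 0 ∧ U = {x | a < inner ℝ x v})) → ∀ (F : Literature.MathematicalPhysics.QuantumLattice.FieldConfig (EuclideanSpace ℝ (Fin 3)) → ℝ), @Measurable _ _ (⨅ (ε : ℝ) (_ : 0 < ε), sig (Metric.thickening ε U)) _ F → (∃ C : ℝ, ∀ ω, |F ω| ≤ C) → MeasureTheory.condExp ((⨅ (ε : ℝ) (_ : 0 < ε), sig (Metric.thickening ε Uᶜ)) ⊔ ⨅ (ε : ℝ) (_ : 0 < ε), sig (Metric.thickening ε (frontier U))) μ F =ᵐ[μ] MeasureTheory.condExp (⨅ (ε : ℝ) (_ : 0 < ε), sig (Metric.thickening ε (frontier U))) μ F) → 1 / 2 ≤ Δ → Δ ≤ 1 → (∀ (n : ℕ) (f : Fin n →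 SchwartzMap (EuclideanSpace ℝ (Fin 3)) ℝ), Literature.MathematicalPhysics.QuantumLattice.moment μ n f = ∫ x : Fin n → EuclideanSpace ℝ (Fin 3), S n x * ∏ i, f i (x i)) → (∀ n z, z ∉ Literature.Probability.LatticeModels.NonCoincident 3 n → S n z = 0) → (∀ n, ContinuousOn (S n) (Literature.Probability.LatticeModels.NonCoincident 3 n)) → Literature.Probability.LatticeModels.IsNondegenerateTwoPoint S → ∃ A : EuclideanSpace ℝ (Fin 3) ≃L[ℝ] EuclideanSpace ℝ (Fin 3), Literature.Probability.LatticeModels.IsRotationInvariant (fun n x => S n (fun i => A (x i))) := by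
  sorry

/-- **stub 3 — inversion covariance from planar RP + sphere-Markov + isotropy** (reversibility
half of NPR; open, XL): under every hypothesis of the crux, any linear image `S ∘ A` that is
Euclidean invariant and scale covariant of weight `Δ` is covariant under the unit inversion. -/
theorem stub_inversion : ∀ (μ : MeasureTheory.Measure (Literature.MathematicalPhysics.QuantumLattice.FieldConfig (EuclideanSpace ℝ (Fin 3)))) (Δ : ℝ) (S : Literature.Probability.LatticeModels.CorrFamily 3), MeasureTheory.IsProbabilityMeasure μ → Literature.MathematicalPhysics.QuantumLattice.HasAllMoments μ → (∀ f : SchwartzMap (EuclideanSpace ℝ (Fin 3)) ℝ, MeasureTheory.Integrable (fun ω : Literature.MathematicalPhysics.QuantumLattice.FieldConfig (EuclideanSpace ℝ (Fin 3)) => Real.exp (ω f)) μ) → Literature.MathematicalPhysics.QuantumLattice.IsTranslationInvariantLaw μ → (∀ (s : ℝ) (hs : 0 < s), MeasureTheory.Measure.map (Literature.MathematicalPhysics.QuantumLattice.FieldConfig.act ((s ^ (Δ - 3 : ℝ)) • Literature.MathematicalPhysics.QuantumLattice.dilateTest s hs.ne')) μ = μ) → Literature.MathematicalPhysics.QuantumLattice.IsTimeReflectionInvariantLaw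 3 μ → (∀ (n : ℕ) (c : Fin n → ℂ) (f : Fin n → SchwartzMap (EuclideanSpace ℝ (Fin 3)) ℝ), (∀ i, tsupport ⇑(f i) ⊆ {x : EuclideanSpace ℝ (Fin 3) | 0 < x 0}) → 0 ≤ (∑ i, ∑ j, (starRingEnd ℂ) (c i) * c j * Literature.MathematicalPhysics.QuantumLattice.genFunctional μ (f j - Literature.MathematicalPhysics.QuantumLattice.thetaTest 3 (f i))).re ∧ (∑ i, ∑ j, (starRingEnd ℂ) (c i) * c j * Literature.MathematicalPhysics.QuantumLattice.genFunctional μ (f j - Literature.MathematicalPhysics.QuantumLattice.thetaTest 3 (f i))).im = 0) → (∀ f g : SchwartzMap (EuclideanSpace ℝ (Fin 3)) ℝ, Filter.Tendsto (fun t : ℝ => Literature.MathematicalPhysics.QuantumLattice.genFunctional μ (f + Literature.MathematicalPhysics.QuantumLattice.timeShiftTest 3 t g)) Filter.atTop (nhds (Literature.MathematicalPhysics.QuantumLattice.genFunctional μ f * Literature.MathematicalPhysics.QuantumLattice.genFunctional μ g))) → (∀ (sig : Set (EuclideanSpace ℝ (Fin 3)) → MeasurableSpace (Literature.MathematicalPhysics.QuantumLattice.FieldConfig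 (EuclideanSpace ℝ (Fin 3)))), (sig = fun A => ⨆ (f : SchwartzMap (EuclideanSpace ℝ (Fin 3)) ℝ) (_ : tsupport ⇑f ⊆ A), MeasurableSpace.comap (fun ω : Literature.MathematicalPhysics.QuantumLattice.FieldConfig (EuclideanSpace ℝ (Fin 3)) => ω f) (borel ℝ)) → ∀ (U : Set (EuclideanSpace ℝ (Fin 3))), ((∃ (c : EuclideanSpace ℝ (Fin 3)) (r : ℝ), U = Metric.ball c r) ∨ (∃ (v : EuclideanSpace ℝ (Fin 3)) (a : ℝ), v ≠ 0 ∧ U = {x | a < inner ℝ x v})) → ∀ (F : Literature.MathematicalPhysics.QuantumLattice.FieldConfig (EuclideanSpace ℝ (Fin 3)) → ℝ), @Measurable _ _ (⨅ (ε : ℝ) (_ : 0 < ε), sig (Metric.thickening ε U)) _ F → (∃ C : ℝ, ∀ ω, |F ω| ≤ C) → MeasureTheory.condExp ((⨅ (ε : ℝ) (_ : 0 < ε), sig (Metric.thickening ε Uᶜ)) ⊔ ⨅ (ε : ℝ) (_ : 0 < ε), sig (Metric.thickening ε (frontier U))) μ F =ᵐ[μ] MeasureTheory.condExp (⨅ (ε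 : ℝ) (_ : 0 < ε), sig (Metric.thickening ε (frontier U))) μ F) → 1 / 2 ≤ Δ → Δ ≤ 1 → (∀ (n : ℕ) (f : Fin n → SchwartzMap (EuclideanSpace ℝ (Fin 3)) ℝ), Literature.MathematicalPhysics.QuantumLattice.moment μ n f = ∫ x : Fin n → EuclideanSpace ℝ (Fin 3), S n x * ∏ i, f i (x i)) → (∀ n z, z ∉ Literature.Probability.LatticeModels.NonCoincident 3 n → S n z = 0) → (∀ n, ContinuousOn (S n) (Literature.Probability.LatticeModels.NonCoincident 3 n)) → Literature.Probability.LatticeModels.IsNondegenerateTwoPoint S → ∀ A : EuclideanSpace ℝ (Fin 3) ≃L[ℝ] EuclideanSpace ℝ (Fin 3), Literature.Probability.LatticeModels.IsEuclideanInvariant (fun n x => S n (fun i => A (x i))) → Literature.Probability.LatticeModels.IsScaleCovariant Δ (fun n x => S n (fun i => A (x i))) → Literature.Probability.LatticeModels.IsInversionCovariant Δ (fun n x => S n (fun i => A (x i))) := by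
  sorry

/-! ## Composition (real proof, no sorry) -/

/-- The composition: the three stub signatures (verbatim) imply the crux. Translation / scale
covariance of `S` are pushed through the linear map `A` (`map_add` / `map_smul`), then the three
conjuncts of `IsMoebiusCovariant` are assembled. -/
theorem NelsonPolyakovRigidity_of :
    (∀ (μ : MeasureTheory.Measure (Literature.MathematicalPhysics.QuantumLattice.FieldConfig (EuclideanSpace ℝ (Fin 3)))) (Δ : ℝ) (S : Literature.Probability.LatticeModels.CorrFamily 3), MeasureTheory.IsProbabilityMeasure μ → Literature.MathematicalPhysics.QuantumLattice.HasAllMoments μ → Literature.MathematicalPhysics.QuantumLattice.IsTranslationInvariantLaw μ → (∀ (s : ℝ) (hs : 0 < s), MeasureTheory.Measure.map (Literature.MathematicalPhysics.QuantumLattice.FieldConfig.act ((s ^ (Δ - 3 : ℝ)) • Literature.MathematicalPhysics.QuantumLattice.dilateTest s hs.ne')) μ = μ) → (∀ (n : ℕ) (f : Fin n → SchwartzMap (EuclideanSpace ℝ (Fin 3)) ℝ), Literature.MathematicalPhysics.QuantumLattice.moment μ n f = ∫ x : Fin n → EuclideanSpace ℝ (Fin 3), S n x * ∏ i, f i (x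 i)) → (∀ n z, z ∉ Literature.Probability.LatticeModels.NonCoincident 3 n → S n z = 0) → (∀ n, ContinuousOn (S n) (Literature.Probability.LatticeModels.NonCoincident 3 n)) → Literature.Probability.LatticeModels.IsTranslationInvariant S ∧ Literature.Probability.LatticeModels.IsScaleCovariant Δ S) →
    (∀ (μ : MeasureTheory.Measure (Literature.MathematicalPhysics.QuantumLattice.FieldConfig (EuclideanSpace ℝ (Fin 3)))) (Δ : ℝ) (S : Literature.Probability.LatticeModels.CorrFamily 3), MeasureTheory.IsProbabilityMeasure μ → Literature.MathematicalPhysics.QuantumLattice.HasAllMoments μ → (∀ f : SchwartzMap (EuclideanSpace ℝ (Fin 3)) ℝ, MeasureTheory.Integrable (fun ω : Literature.MathematicalPhysics.QuantumLattice.FieldConfig (EuclideanSpace ℝ (Fin 3)) => Real.exp (ω f)) μ) → Literature.MathematicalPhysics.QuantumLattice.IsTranslationInvariantLaw μ → (∀ (s : ℝ) (hs : 0 < s), MeasureTheory.Measure.map (Literature.MathematicalPhysics.QuantumLattice.FieldConfig.act ((s ^ (Δ - 3 : ℝ)) • Literature.MathematicalPhysics.QuantumLattice.dilateTest s hs.ne'))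 μ = μ) → Literature.MathematicalPhysics.QuantumLattice.IsTimeReflectionInvariantLaw 3 μ → (∀ (n : ℕ) (c : Fin n → ℂ) (f : Fin n → SchwartzMap (EuclideanSpace ℝ (Fin 3)) ℝ), (∀ i, tsupport ⇑(f i) ⊆ {x : EuclideanSpace ℝ (Fin 3) | 0 < x 0}) → 0 ≤ (∑ i, ∑ j, (starRingEnd ℂ) (c i) * c j * Literature.MathematicalPhysics.QuantumLattice.genFunctional μ (f j - Literature.MathematicalPhysics.QuantumLattice.thetaTest 3 (f i))).re ∧ (∑ i, ∑ j, (starRingEnd ℂ) (c i) * c j * Literature.MathematicalPhysics.QuantumLattice.genFunctional μ (f j - Literature.MathematicalPhysics.QuantumLattice.thetaTest 3 (f i))).im = 0) → (∀ f g : SchwartzMap (EuclideanSpace ℝ (Fin 3)) ℝ, Filter.Tendsto (fun t : ℝ => Literature.MathematicalPhysics.QuantumLattice.genFunctional μ (f + Literature.MathematicalPhysics.QuantumLattice.timeShiftTest 3 t g)) Filter.atTop (nhds (Literature.MathematicalPhysics.QuantumLattice.genFunctional μ f * Literature.MathematicalPhysics.QuantumLattice.genFunctional μ g))) → (∀ (sig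 : Set (EuclideanSpace ℝ (Fin 3)) → MeasurableSpace (Literature.MathematicalPhysics.QuantumLattice.FieldConfig (EuclideanSpace ℝ (Fin 3)))), (sig = fun A => ⨆ (f : SchwartzMap (EuclideanSpace ℝ (Fin 3)) ℝ) (_ : tsupport ⇑f ⊆ A), MeasurableSpace.comap (fun ω : Literature.MathematicalPhysics.QuantumLattice.FieldConfig (EuclideanSpace ℝ (Fin 3)) => ω f) (borel ℝ)) → ∀ (U : Set (EuclideanSpace ℝ (Fin 3))), ((∃ (c : EuclideanSpace ℝ (Fin 3)) (r : ℝ), U = Metric.ball c r) ∨ (∃ (v : EuclideanSpace ℝ (Fin 3)) (a : ℝ), v ≠ 0 ∧ U = {x | a < inner ℝ x v})) → ∀ (F : Literature.MathematicalPhysics.QuantumLattice.FieldConfig (EuclideanSpace ℝ (Fin 3)) → ℝ), @Measurable _ _ (⨅ (ε : ℝ) (_ : 0 < ε), sig (Metric.thickening ε U)) _ F → (∃ C : ℝ, ∀ ω, |F ω| ≤ C) → MeasureTheory.condExp ((⨅ (ε : ℝ) (_ : 0 < ε), sig (Metric.thickening ε Uᶜ)) ⊔ ⨅ (ε : ℝ)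 (_ : 0 < ε), sig (Metric.thickening ε (frontier U))) μ F =ᵐ[μ] MeasureTheory.condExp (⨅ (ε : ℝ) (_ : 0 < ε), sig (Metric.thickening ε (frontier U))) μ F) → 1 / 2 ≤ Δ → Δ ≤ 1 → (∀ (n : ℕ) (f : Fin n → SchwartzMap (EuclideanSpace ℝ (Fin 3)) ℝ), Literature.MathematicalPhysics.QuantumLattice.moment μ n f = ∫ x : Fin n → EuclideanSpace ℝ (Fin 3), S n x * ∏ i, f i (x i)) → (∀ n z, z ∉ Literature.Probability.LatticeModels.NonCoincident 3 n → S n z = 0) → (∀ n, ContinuousOn (S n) (Literature.Probability.LatticeModels.NonCoincident 3 n)) → Literature.Probability.LatticeModels.IsNondegenerateTwoPoint S → ∃ A : EuclideanSpace ℝ (Fin 3) ≃L[ℝ] EuclideanSpace ℝ (Fin 3), Literature.Probability.LatticeModels.IsRotationInvariant (fun n x => S n (fun i => A (x i)))) →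
    (∀ (μ : MeasureTheory.Measure (Literature.MathematicalPhysics.QuantumLattice.FieldConfig (EuclideanSpace ℝ (Fin 3)))) (Δ : ℝ) (S : Literature.Probability.LatticeModels.CorrFamily 3), MeasureTheory.IsProbabilityMeasure μ → Literature.MathematicalPhysics.QuantumLattice.HasAllMoments μ → (∀ f : SchwartzMap (EuclideanSpace ℝ (Fin 3)) ℝ, MeasureTheory.Integrable (fun ω : Literature.MathematicalPhysics.QuantumLattice.FieldConfig (EuclideanSpace ℝ (Fin 3)) => Real.exp (ω f)) μ) → Literature.MathematicalPhysics.QuantumLattice.IsTranslationInvariantLaw μ → (∀ (s : ℝ) (hs : 0 < s), MeasureTheory.Measure.map (Literature.MathematicalPhysics.QuantumLattice.FieldConfig.act ((s ^ (Δ - 3 : ℝ)) • Literature.MathematicalPhysics.QuantumLattice.dilateTest s hs.ne')) μ = μ) → Literature.MathematicalPhysics.QuantumLattice.IsTimeReflectionInvariantLaw 3 μ → (∀ (n : ℕ) (c : Fin n → ℂ) (f : Fin n → SchwartzMap (EuclideanSpace ℝ (Fin 3)) ℝ), (∀ i, tsupport ⇑(f i) ⊆ {x : EuclideanSpace ℝ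 (Fin 3) | 0 < x 0}) → 0 ≤ (∑ i, ∑ j, (starRingEnd ℂ) (c i) * c j * Literature.MathematicalPhysics.QuantumLattice.genFunctional μ (f j - Literature.MathematicalPhysics.QuantumLattice.thetaTest 3 (f i))).re ∧ (∑ i, ∑ j, (starRingEnd ℂ) (c i) * c j * Literature.MathematicalPhysics.QuantumLattice.genFunctional μ (f j - Literature.MathematicalPhysics.QuantumLattice.thetaTest 3 (f i))).im = 0) → (∀ f g : SchwartzMap (EuclideanSpace ℝ (Fin 3)) ℝ, Filter.Tendsto (fun t : ℝ => Literature.MathematicalPhysics.QuantumLattice.genFunctional μ (f + Literature.MathematicalPhysics.QuantumLattice.timeShiftTest 3 t g)) Filter.atTop (nhds (Literature.MathematicalPhysics.QuantumLattice.genFunctional μ f * Literature.MathematicalPhysics.QuantumLattice.genFunctional μ g))) → (∀ (sig : Set (EuclideanSpace ℝ (Fin 3)) → MeasurableSpace (Literature.MathematicalPhysics.QuantumLattice.FieldConfig (EuclideanSpace ℝ (Fin 3)))), (sig = fun A => ⨆ (f : SchwartzMap (EuclideanSpace ℝ (Fin 3)) ℝ) (_ : tsupport ⇑f ⊆ A),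 MeasurableSpace.comap (fun ω : Literature.MathematicalPhysics.QuantumLattice.FieldConfig (EuclideanSpace ℝ (Fin 3)) => ω f) (borel ℝ)) → ∀ (U : Set (EuclideanSpace ℝ (Fin 3))), ((∃ (c : EuclideanSpace ℝ (Fin 3)) (r : ℝ), U = Metric.ball c r) ∨ (∃ (v : EuclideanSpace ℝ (Fin 3)) (a : ℝ), v ≠ 0 ∧ U = {x | a < inner ℝ x v})) → ∀ (F : Literature.MathematicalPhysics.QuantumLattice.FieldConfig (EuclideanSpace ℝ (Fin 3)) → ℝ), @Measurable _ _ (⨅ (ε : ℝ) (_ : 0 < ε), sig (Metric.thickening ε U)) _ F → (∃ C : ℝ, ∀ ω, |F ω| ≤ C) → MeasureTheory.condExp ((⨅ (ε : ℝ) (_ : 0 < ε), sig (Metric.thickening ε Uᶜ)) ⊔ ⨅ (ε : ℝ) (_ : 0 < ε), sig (Metric.thickening ε (frontier U))) μ F =ᵐ[μ] MeasureTheory.condExp (⨅ (ε : ℝ) (_ : 0 < ε), sig (Metric.thickening ε (frontier U))) μ F) → 1 / 2 ≤ Δ → Δ ≤ 1 → (∀ (n : ℕ) (f : Fin n → SchwartzMap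 (EuclideanSpace ℝ (Fin 3)) ℝ), Literature.MathematicalPhysics.QuantumLattice.moment μ n f = ∫ x : Fin n → EuclideanSpace ℝ (Fin 3), S n x * ∏ i, f i (x i)) → (∀ n z, z ∉ Literature.Probability.LatticeModels.NonCoincident 3 n → S n z = 0) → (∀ n, ContinuousOn (S n) (Literature.Probability.LatticeModels.NonCoincident 3 n)) → Literature.Probability.LatticeModels.IsNondegenerateTwoPoint S → ∀ A : EuclideanSpace ℝ (Fin 3) ≃L[ℝ] EuclideanSpace ℝ (Fin 3), Literature.Probability.LatticeModels.IsEuclideanInvariant (fun n x => S n (fun i => A (x i))) → Literature.Probability.LatticeModels.IsScaleCovariant Δ (fun n x => S n (fun i => A (x i))) → Literature.Probability.LatticeModels.IsInversionCovariant Δ (fun n x => S n (fun i => A (x i)))) →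
      NelsonPolyakovRigidity := by
  intro hT hI hV μ Δ S hprob hmom hexp htrl hscl hθ hrp hcl hmk hΔ1 hΔ2 hdens hnorm hcont hnd
  obtain ⟨htr, hsc⟩ := hT μ Δ S hprob hmom htrl hscl hdens hnorm hcont
  obtain ⟨A, hrot⟩ := hI μ Δ S hprob hmom hexp htrl hscl hθ hrp hcl hmk hΔ1 hΔ2 hdens hnorm hcont hnd
  have htrA : Literature.Probability.LatticeModels.IsTranslationInvariant
      (fun n x => S n (fun i => A (x i))) := by
    intro n v x
    simpa only [map_add] using htr n (A v) (fun i => A (x i))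
  have hscA : Literature.Probability.LatticeModels.IsScaleCovariant Δ
      (fun n x => S n (fun i => A (x i))) := by
    intro n c hc x
    simpa only [map_smul] using hsc n c hc (fun i => A (x i))
  have heuc : Literature.Probability.LatticeModels.IsEuclideanInvariant
      (fun n x => S n (fun i => A (x i))) := ⟨htrA, hrot⟩
  exact ⟨A, heuc, hscA,
    hV μ Δ S hprob hmom hexp htrl hscl hθ hrp hcl hmk hΔ1 hΔ2 hdens hnorm hcont hnd A heuc hscA⟩

/-- The skeleton theorem: concludes the route decl BY NAME from the composition and the three
(sorried) stubs — it becomes the crux proof once the stubs land (`propose --supports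
stmt-CriticalPhenomena-11243` per stub, then this file `--workitem`). -/
theorem NelsonPolyakovRigidity_skeleton :
    Summit.CriticalPhenomena.Ising3DConformalLimit.Theses.MarkovRigidity.NelsonPolyakovRigidity :=
  NelsonPolyakovRigidity_of stub_transport stub_isotropy stub_inversion

end Summit.CriticalPhenomena.Ising3DConformalLimit.Cruxes.NelsonPolyakovRigidity.Birth
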